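import Mathlib
import Summits.QuantumFields.YangMills.Theorems.ComplexCouplingChannelContinuumLegGivenGapKLSepStrict
import Summits.QuantumFields.YangMills.Theorems.ComplexCouplingChannelContinuumLegGivenGapKLSepRadialBump
import Summits.QuantumFields.YangMills.Theorems.PencilRigidityCurvatureKernelBoundTensorRegularityPlaneWave
import Summits.QuantumFields.YangMills.Theorems.ComplexCouplingChannelContinuumLegGivenGapStubRotationToAxis
import Summits.QuantumFields.YangMills.Theorems.ComplexCouplingChannelContinuumLegGivenGapStubApproxIdentity
import HarnessLib

/-!
# Crux `ContinuumLegGivenGap` (stmt-QuantumFields-15828), line `duality-selection-nlo-skewness`: registered stub `stub_KLSep_of`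

The lead's assembly (reshape c15-1; blueprint `Cruxes/ContinuumLegGivenGap/Lines/duality-selection-KL-blueprint.md`,
item (P4)): from the registered statement of `stub_bumpPairPositivity` (hypothesis; its content is the landed
`BumpPair.positivity_dichotomy`) and the LANDED `stub_rotationToAxis` (p172758), `stub_approxIdentity` (p172773),
`stub_nonnegSeparated` (p172995), used by name, to **Källén–Lehmann positivity on separated supports** (`KLSep`): for OS data `T`, a non-trivial
species `s` and real non-negative non-zero `f, g` whose supports are at positive distance,
`Re (𝔖₂(f ⊗ g) − 𝔖₁(f)𝔖₁(g)) > 0`.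

Proof. Pick `a` with `f(a) > 0`, `b` with `g(b) > 0` (so `a ≠ b`, indeed `dist a b ≥ δ`); by continuity `f > f(a)/2`
near `a`, `g > g(b)/2` near `b`. The strict-positivity lemma `exists_re_truncated_bumpPair_pos` (non-triviality +
dichotomy + approximate identity; `…KLSepStrict`) gives a radius `r` below these scales with
`Re W(φ_a, φ_b) > 0` for the mass-one radial bump `φ = Φ r` of `exists_unitRadialBump`. With `c = m / M`
(`m = min(f(a), g(b))/2`, `M = sup|φ|`), `f₁ = f − cφ_a ≥ 0` and `g₁ = g − cφ_b ≥ 0` are real Schwartz functions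
supported inside `tsupport f`, `tsupport g`, so `(f₁, g)` and `(cφ_a, g₁)` are again `δ`-separated non-negative
pairs and `stub_nonnegSeparated` (fed by the same bump family at radii `1/(n+1)`, `stub_approxIdentity` and the
non-negativity half of `stub_bumpPairPositivity`) gives `Re W ≥ 0` for both; bilinearity
`W(f,g) = W(f₁,g) + W(cφ_a, g₁) + c² W(φ_a,φ_b)` finishes. Everything is proved.
-/

noncomputable section

namespace Summit.QuantumFields.YangMills.Cruxes.ContinuumLegGivenGap.DualitySelectionNloSkewness

open scoped SchwartzMap InnerProductSpace ComplexConjugate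
open Filter Topology MeasureTheory Set Metric
open Literature.MathematicalPhysics.QuantumFieldTheory Literature.MathematicalPhysics.QuantumLattice
  Literature.MathematicalPhysics.AQFT Literature.Analysis.FunctionSpaces
open Summit.QuantumFields.YangMills.Theorems.CurvatureKernel

/-! ### Tensor bookkeeping -/

section Tensor

variable {E : Type*} [NormedAddCommGroup E] [NormedSpace ℝ E]

/-- Homogeneity of the one-point lift. [folklore] -/
theorem tensorFin_one_smul (c : ℂ) (f : 𝓢(E, ℂ)) :
    SchwartzMap.tensorFin 1 ![c • f] = c • SchwartzMap.tensorFin 1 ![f] := by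
  ext x
  simp only [tensorFin_one_eval, smul_apply]

end Tensor

/-! ### Local facts on real non-negative test functions -/

variable {d : ℕ}

/-- A non-zero real non-negative test function is strictly positive somewhere. [folklore] -/
theorem exists_re_pos_of_ne_zero {f : 𝓢(EuclideanSpace ℝ (Fin d), ℂ)}
    (hre : ∀ x, (f x).im = 0 ∧ 0 ≤ (f x).re) (hf : f ≠ 0) :
    ∃ a, 0 < (f a).re := by
  by_contra hcon
  push Not at hcon
  refine hf ?_
  ext x
  rw [zero_apply]
  refine Complex.ext ?_ ?_
  · rw [Complex.zero_re]
    exact le_antisymm (hcon x) (hre x).2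
  · rw [Complex.zero_im]
    exact (hre x).1

/-- Continuity: a test function stays above half its value on a small closed ball. [folklore] -/
theorem exists_ball_re_gt_half (f : 𝓢(EuclideanSpace ℝ (Fin d), ℂ)) {a : EuclideanSpace ℝ (Fin d)}
    (ha : 0 < (f a).re) :
    ∃ ρ : ℝ, 0 < ρ ∧ ∀ x, dist x a ≤ ρ → (f a).re / 2 < (f x).re := by
  have hc : ContinuousAt (fun x => (f x).re) a := (Complex.continuous_re.comp f.continuous).continuousAt
  have hev : ∀ᶠ x in 𝓝 a, (f a).re / 2 < (f x).re :=
    hc.eventually (lt_mem_nhds (by linarith))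
  obtain ⟨ε, hε, hball⟩ := Metric.eventually_nhds_iff.1 hev
  exact ⟨ε / 2, by positivity, fun x hx => hball (lt_of_le_of_lt hx (by linarith))⟩

/-- Points charged by a translated bump of radius `r` lie in the closed ball around the centre. [folklore] -/
theorem mem_closedBall_of_compSubConstCLM_ne_zero {φ : 𝓢(EuclideanSpace ℝ (Fin d), ℂ)} {r : ℝ}
    (hsupp : tsupport (φ : EuclideanSpace ℝ (Fin d) → ℂ) ⊆ closedBall 0 r) {a x : EuclideanSpace ℝ (Fin d)}
    (hx : SchwartzMap.compSubConstCLM ℂ a φ x ≠ 0) : dist x a ≤ r := by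
  rw [SchwartzMap.compSubConstCLM_apply] at hx
  have h := hsupp (subset_tsupport _ (Function.mem_support.2 hx))
  rwa [mem_closedBall_zero_iff, ← dist_eq_norm] at h

/-- The support of a translated bump of radius `r` lies in the closed ball around the centre. [folklore] -/
theorem tsupport_compSubConstCLM_subset_closedBall {φ : 𝓢(EuclideanSpace ℝ (Fin d), ℂ)} {r : ℝ}
    (hsupp : tsupport (φ : EuclideanSpace ℝ (Fin d) → ℂ) ⊆ closedBall 0 r) (a : EuclideanSpace ℝ (Fin d)) :
    tsupport ((SchwartzMap.compSubConstCLM ℂ a φ : 𝓢(EuclideanSpace ℝ (Fin d), ℂ)) :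
      EuclideanSpace ℝ (Fin d) → ℂ) ⊆ closedBall a r := by
  refine closure_minimal (fun x hx => ?_) isClosed_closedBall
  exact mem_closedBall.2 (mem_closedBall_of_compSubConstCLM_ne_zero hsupp (Function.mem_support.1 hx))

variable [NeZero d]

/-! ### The registered stub -/

/-- `stub_KLSep_of` — **the lead's assembly** (registered, line `duality-selection-nlo-skewness`, reshape c15-1):
from the statements of `stub_rotationToAxis`, `stub_approxIdentity`, `stub_bumpPairPositivity` and
`stub_nonnegSeparated` to Källén–Lehmann positivity on separated supports. See the module docstring. [folklore] -/
theorem stub_KLSep_of :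
    (∀ (ι : Type) (d : ℕ) [NeZero d] (T : OSData ι d) (s : ι)
      (φ : 𝓢(EuclideanSpace ℝ (Fin d), ℂ)) (r : ℝ), 0 < r →
      (∀ x, (φ x).im = 0 ∧ 0 ≤ (φ x).re) →
      (∀ (L : EuclideanSpace ℝ (Fin d) ≃ₗᵢ[ℝ] EuclideanSpace ℝ (Fin d)) (x : EuclideanSpace ℝ (Fin d)), φ (L x) = φ x) →
      tsupport (φ : EuclideanSpace ℝ (Fin d) → ℂ) ⊆ Metric.closedBall 0 r →
      (2 ≤ d → ∀ u v : EuclideanSpace ℝ (Fin d), ‖u‖ = ‖v‖ →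
        ∃ R : EuclideanSpace ℝ (Fin d) ≃ₗᵢ[ℝ] EuclideanSpace ℝ (Fin d),
          LinearMap.det (R.toLinearEquiv : EuclideanSpace ℝ (Fin d) →ₗ[ℝ] EuclideanSpace ℝ (Fin d)) = 1 ∧ R u = v) →
      ∀ W : EuclideanSpace ℝ (Fin d) → EuclideanSpace ℝ (Fin d) → ℂ,
      (∀ a b, W a b =
        T.schwinger 2 (fun _ => s) (SchwartzMap.tensorFin 2
            ![SchwartzMap.compSubConstCLM ℂ a φ, SchwartzMap.compSubConstCLM ℂ b φ]) -
          T.schwinger 1 (fun _ => s) (SchwartzMap.tensorFin 1 ![SchwartzMap.compSubConstCLM ℂ a φ]) *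
            T.schwinger 1 (fun _ => s) (SchwartzMap.tensorFin 1 ![SchwartzMap.compSubConstCLM ℂ b φ])) →
      (∀ a b : EuclideanSpace ℝ (Fin d), 2 * r < dist a b → 0 ≤ (W a b).re ∧ (W a b).im = 0) ∧
      (∀ a b a' b' : EuclideanSpace ℝ (Fin d), 2 * r < dist a b → dist a b = dist a' b' → W a b = W a' b') ∧
      ((∃ a b : EuclideanSpace ℝ (Fin d), 2 * r < dist a b ∧ (W a b).re = 0) →
        ∀ a b : EuclideanSpace ℝ (Fin d), 2 * r < dist a b → (W a b).re = 0)) →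
    (∀ (ι : Type) (d : ℕ) [NeZero d] (T : OSData ι d) (s : ι), T.IsNontrivial s →
      ∀ (f g : 𝓢(EuclideanSpace ℝ (Fin d), ℂ)) (F₂ : 𝓢((Fin 2 → EuclideanSpace ℝ (Fin d)), ℂ))
        (Ff Fg : 𝓢((Fin 1 → EuclideanSpace ℝ (Fin d)), ℂ)),
        IsTensorOf F₂ ![f, g] → IsTensorOf Ff ![f] → IsTensorOf Fg ![g] →
        (∀ x, (f x).im = 0 ∧ 0 ≤ (f x).re ∧ (g x).im = 0 ∧ 0 ≤ (g x).re) → f ≠ 0 → g ≠ 0 →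
        (∃ δ : ℝ, 0 < δ ∧ ∀ x ∈ tsupport (f : EuclideanSpace ℝ (Fin d) → ℂ),
            ∀ y ∈ tsupport (g : EuclideanSpace ℝ (Fin d) → ℂ), δ ≤ dist x y) →
        0 < (T.schwinger 2 (fun _ => s) F₂ -
          T.schwinger 1 (fun _ => s) Ff * T.schwinger 1 (fun _ => s) Fg).re) := by
  intro hbump ι d _ T s hNT f g F₂ Ff Fg hF₂ hFf hFg hre hf0 hg0 hsep
  have hrot := stub_rotationToAxis
  have happrox := stub_approxIdentity
  have hnonneg := stub_nonnegSeparated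
  obtain ⟨δ, hδ, hsep⟩ := hsep
  -- the tensor witnesses are the canonical ones
  rw [hF₂.unique (isTensorOf_tensorFin _), hFf.unique (isTensorOf_tensorFin _), hFg.unique (isTensorOf_tensorFin _)]
  -- the radial mass-one bump family
  have hex : ∀ r : ℝ, 0 < r → ∃ φ : 𝓢(EuclideanSpace ℝ (Fin d), ℂ),
      (∀ x, (φ x).im = 0 ∧ 0 ≤ (φ x).re) ∧
      (∀ (L : EuclideanSpace ℝ (Fin d) ≃ₗᵢ[ℝ] EuclideanSpace ℝ (Fin d)) (x : EuclideanSpace ℝ (Fin d)), φ (L x) = φ x) ∧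
      tsupport (φ : EuclideanSpace ℝ (Fin d) → ℂ) ⊆ closedBall 0 r ∧ (∫ x, φ x) = 1 ∧ 0 < (φ 0).re :=
    fun r hr => exists_unitRadialBump d hr
  choose Φ₀ hΦ₀ using hex
  set Φ : ℝ → 𝓢(EuclideanSpace ℝ (Fin d), ℂ) := fun r => if hr : 0 < r then Φ₀ r hr else 0 with hΦdef
  have hΦ : ∀ r (hr : 0 < r), Φ r = Φ₀ r hr := fun r hr => by rw [hΦdef]; simp only [dif_pos hr]
  have hΦre : ∀ r, 0 < r → ∀ x, (Φ r x).im = 0 ∧ 0 ≤ (Φ r x).re := fun r hr => by rw [hΦ r hr]; exact (hΦ₀ r hr).1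
  have hΦrad : ∀ r, 0 < r → ∀ (L : EuclideanSpace ℝ (Fin d) ≃ₗᵢ[ℝ] EuclideanSpace ℝ (Fin d))
      (x : EuclideanSpace ℝ (Fin d)), Φ r (L x) = Φ r x := fun r hr => by rw [hΦ r hr]; exact (hΦ₀ r hr).2.1
  have hΦsupp : ∀ r, 0 < r → tsupport (Φ r : EuclideanSpace ℝ (Fin d) → ℂ) ⊆ closedBall 0 r :=
    fun r hr => by rw [hΦ r hr]; exact (hΦ₀ r hr).2.2.1
  have hΦmass : ∀ r, 0 < r → ∫ x, Φ r x = 1 := fun r hr => by rw [hΦ r hr]; exact (hΦ₀ r hr).2.2.2.1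
  have hΦpos : ∀ r, 0 < r → 0 < (Φ r 0).re := fun r hr => by rw [hΦ r hr]; exact (hΦ₀ r hr).2.2.2.2
  -- the points `a`, `b` and their positivity balls
  obtain ⟨a, ha⟩ := exists_re_pos_of_ne_zero (fun x => ⟨(hre x).1, (hre x).2.1⟩) hf0
  obtain ⟨b, hb⟩ := exists_re_pos_of_ne_zero (fun x => ⟨(hre x).2.2.1, (hre x).2.2.2⟩) hg0
  have hfa0 : f a ≠ 0 := fun h0 => by rw [h0, Complex.zero_re] at ha; exact lt_irrefl _ ha
  have hgb0 : g b ≠ 0 := fun h0 => by rw [h0, Complex.zero_re] at hb; exact lt_irrefl _ hb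
  have hat : a ∈ tsupport (f : EuclideanSpace ℝ (Fin d) → ℂ) := subset_tsupport _ hfa0
  have hbt : b ∈ tsupport (g : EuclideanSpace ℝ (Fin d) → ℂ) := subset_tsupport _ hgb0
  have hab' : δ ≤ dist a b := hsep a hat b hbt
  have hab : a ≠ b := fun h0 => by rw [h0, dist_self] at hab'; exact absurd hab' (not_le.2 hδ)
  obtain ⟨ρ₁, hρ₁, hball₁⟩ := exists_ball_re_gt_half f ha
  obtain ⟨ρ₂, hρ₂, hball₂⟩ := exists_ball_re_gt_half g hb
  -- the radius from strict positivity of small bump pairs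
  obtain ⟨r, hr, hrle, hrsep, hWpos⟩ := exists_re_truncated_bumpPair_pos hrot happrox
    (fun ι d _ T s φ r hr hφ hrad' hsupp hrot' => hbump ι d T s φ r hr hφ hrad' hsupp hrot' _ (fun _ _ => rfl))
    T s hNT Φ hΦre hΦrad hΦsupp hΦmass hab (lt_min hρ₁ hρ₂)
  have hr₁ : r ≤ ρ₁ := hrle.trans (min_le_left _ _)
  have hr₂ : r ≤ ρ₂ := hrle.trans (min_le_right _ _)
  set φ := Φ r with hφdef
  set φa : 𝓢(EuclideanSpace ℝ (Fin d), ℂ) := SchwartzMap.compSubConstCLM ℂ a φ with hφa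
  set φb : 𝓢(EuclideanSpace ℝ (Fin d), ℂ) := SchwartzMap.compSubConstCLM ℂ b φ with hφb
  -- the bound `M` on `φ` and the constant `c`
  set M : ℝ := SchwartzMap.seminorm ℂ 0 0 φ with hM
  have hφle : ∀ x, (φ x).re ≤ M := fun x => (Complex.re_le_norm _).trans (SchwartzMap.norm_le_seminorm ℂ φ x)
  have hMpos : 0 < M := lt_of_lt_of_le (hΦpos r hr) (hφle 0)
  set m : ℝ := min ((f a).re / 2) ((g b).re / 2) with hm
  have hmpos : 0 < m := lt_min (by linarith) (by linarith)
  set c : ℝ := m / M with hc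
  have hcpos : 0 < c := div_pos hmpos hMpos
  have hcφ : ∀ x, c * (φ x).re ≤ m := fun x => by
    rw [hc, div_mul_eq_mul_div, div_le_iff₀ hMpos]
    exact mul_le_mul_of_nonneg_left (hφle x) hmpos.le
  -- the remainders
  set f₁ : 𝓢(EuclideanSpace ℝ (Fin d), ℂ) := f - (c : ℂ) • φa with hf₁
  set g₁ : 𝓢(EuclideanSpace ℝ (Fin d), ℂ) := g - (c : ℂ) • φb with hg₁
  have hφa_re : ∀ x, (φa x).im = 0 ∧ 0 ≤ (φa x).re := fun x => by
    rw [hφa, SchwartzMap.compSubConstCLM_apply]; exact hΦre r hr _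
  have hφb_re : ∀ x, (φb x).im = 0 ∧ 0 ≤ (φb x).re := fun x => by
    rw [hφb, SchwartzMap.compSubConstCLM_apply]; exact hΦre r hr _
  have hcφa : ∀ x, (((c : ℂ) • φa) x).im = 0 ∧ 0 ≤ (((c : ℂ) • φa) x).re ∧ (((c : ℂ) • φa) x).re ≤ m := fun x => by
    rw [smul_apply, smul_eq_mul, Complex.re_ofReal_mul, Complex.im_ofReal_mul, (hφa_re x).1, mul_zero]
    refine ⟨rfl, mul_nonneg hcpos.le (hφa_re x).2, ?_⟩
    rw [hφa, SchwartzMap.compSubConstCLM_apply]; exact hcφ _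
  have hcφb : ∀ x, (((c : ℂ) • φb) x).im = 0 ∧ 0 ≤ (((c : ℂ) • φb) x).re ∧ (((c : ℂ) • φb) x).re ≤ m := fun x => by
    rw [smul_apply, smul_eq_mul, Complex.re_ofReal_mul, Complex.im_ofReal_mul, (hφb_re x).1, mul_zero]
    refine ⟨rfl, mul_nonneg hcpos.le (hφb_re x).2, ?_⟩
    rw [hφb, SchwartzMap.compSubConstCLM_apply]; exact hcφ _
  -- `f₁ ≥ 0`, `g₁ ≥ 0`
  have hf₁re : ∀ x, (f₁ x).im = 0 ∧ 0 ≤ (f₁ x).re := by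
    intro x
    rw [hf₁, sub_apply, Complex.sub_im, Complex.sub_re, (hre x).1, (hcφa x).1, sub_zero]
    refine ⟨rfl, ?_⟩
    by_cases hx : φa x = 0
    · have : ((c : ℂ) • φa) x = 0 := by rw [smul_apply, hx, smul_zero]
      rw [this, Complex.zero_re, sub_zero]; exact (hre x).2.1
    · have hxa : dist x a ≤ ρ₁ := (mem_closedBall_of_compSubConstCLM_ne_zero (hΦsupp r hr) hx).trans hr₁
      have h1 := hball₁ x hxa
      have h2 : (((c : ℂ) • φa) x).re ≤ (f a).re / 2 := (hcφa x).2.2.trans (min_le_left _ _)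
      linarith
  have hg₁re : ∀ x, (g₁ x).im = 0 ∧ 0 ≤ (g₁ x).re := by
    intro x
    rw [hg₁, sub_apply, Complex.sub_im, Complex.sub_re, (hre x).2.2.1, (hcφb x).1, sub_zero]
    refine ⟨rfl, ?_⟩
    by_cases hx : φb x = 0
    · have : ((c : ℂ) • φb) x = 0 := by rw [smul_apply, hx, smul_zero]
      rw [this, Complex.zero_re, sub_zero]; exact (hre x).2.2.2
    · have hxb : dist x b ≤ ρ₂ := (mem_closedBall_of_compSubConstCLM_ne_zero (hΦsupp r hr) hx).trans hr₂
      have h1 := hball₂ x hxb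
      have h2 : (((c : ℂ) • φb) x).re ≤ (g b).re / 2 := (hcφb x).2.2.trans (min_le_right _ _)
      linarith
  -- supports: the bumps live inside `tsupport f`, `tsupport g`
  have hφa_supp : tsupport (((c : ℂ) • φa : 𝓢(EuclideanSpace ℝ (Fin d), ℂ)) : EuclideanSpace ℝ (Fin d) → ℂ) ⊆
      tsupport (f : EuclideanSpace ℝ (Fin d) → ℂ) := by
    refine (tsupport_smul_subset_right (fun _ : EuclideanSpace ℝ (Fin d) => (c : ℂ)) (φa : EuclideanSpace ℝ (Fin d) → ℂ)).trans ?_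
    refine (tsupport_compSubConstCLM_subset_closedBall (hΦsupp r hr) a).trans fun x hx => ?_
    refine subset_tsupport _ (Function.mem_support.2 fun h0 => ?_)
    have h1 := hball₁ x ((mem_closedBall.1 hx).trans hr₁)
    rw [h0, Complex.zero_re] at h1
    linarith
  have hφb_supp : tsupport (((c : ℂ) • φb : 𝓢(EuclideanSpace ℝ (Fin d), ℂ)) : EuclideanSpace ℝ (Fin d) → ℂ) ⊆
      tsupport (g : EuclideanSpace ℝ (Fin d) → ℂ) := by
    refine (tsupport_smul_subset_right (fun _ : EuclideanSpace ℝ (Fin d) => (c : ℂ)) (φb : EuclideanSpace ℝ (Fin d) → ℂ)).trans ?_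
    refine (tsupport_compSubConstCLM_subset_closedBall (hΦsupp r hr) b).trans fun x hx => ?_
    refine subset_tsupport _ (Function.mem_support.2 fun h0 => ?_)
    have h1 := hball₂ x ((mem_closedBall.1 hx).trans hr₂)
    rw [h0, Complex.zero_re] at h1
    linarith
  have hf₁_supp : tsupport (f₁ : EuclideanSpace ℝ (Fin d) → ℂ) ⊆ tsupport (f : EuclideanSpace ℝ (Fin d) → ℂ) := by
    rw [hf₁]
    refine (tsupport_sub (f : EuclideanSpace ℝ (Fin d) → ℂ) _).trans (union_subset subset_rfl hφa_supp)
  have hg₁_supp : tsupport (g₁ : EuclideanSpace ℝ (Fin d) → ℂ) ⊆ tsupport (g : EuclideanSpace ℝ (Fin d) → ℂ) := by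
    rw [hg₁]
    refine (tsupport_sub (g : EuclideanSpace ℝ (Fin d) → ℂ) _).trans (union_subset subset_rfl hφb_supp)
  -- the kernel family at radii `1/(n+1)` and the non-negativity statement it feeds
  set rn : ℕ → ℝ := fun n => 1 / ((n : ℝ) + 1) with hrn
  have hrn_pos : ∀ n, 0 < rn n := fun n => by positivity
  have hrn_tendsto : Tendsto rn atTop (𝓝 0) := tendsto_one_div_add_atTop_nhds_zero_nat
  have hNN : ∀ (f' g' : 𝓢(EuclideanSpace ℝ (Fin d), ℂ)),
      (∀ x, (f' x).im = 0 ∧ 0 ≤ (f' x).re ∧ (g' x).im = 0 ∧ 0 ≤ (g' x).re) →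
      (∃ δ : ℝ, 0 < δ ∧ ∀ x ∈ tsupport (f' : EuclideanSpace ℝ (Fin d) → ℂ),
        ∀ y ∈ tsupport (g' : EuclideanSpace ℝ (Fin d) → ℂ), δ ≤ dist x y) →
      0 ≤ (T.schwinger 2 (fun _ => s) (SchwartzMap.tensorFin 2 ![f', g']) -
        T.schwinger 1 (fun _ => s) (SchwartzMap.tensorFin 1 ![f']) *
          T.schwinger 1 (fun _ => s) (SchwartzMap.tensorFin 1 ![g'])).re := by
    refine hnonneg ι d T s (fun n => Φ (rn n)) rn hrn_pos hrn_tendsto (fun n => hΦre _ (hrn_pos n))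
      (fun n => hΦmass _ (hrn_pos n)) (fun n => hΦsupp _ (hrn_pos n)) ?_ ?_
    · exact happrox d (fun n => Φ (rn n)) rn (fun n => hΦre _ (hrn_pos n)) (fun n => hΦmass _ (hrn_pos n))
        (fun n => hΦsupp _ (hrn_pos n)) hrn_tendsto
    · intro n a' b' hsep'
      obtain ⟨h1, -, -⟩ := hbump ι d T s (Φ (rn n)) (rn n) (hrn_pos n) (hΦre _ (hrn_pos n))
        (hΦrad _ (hrn_pos n)) (hΦsupp _ (hrn_pos n)) (hrot d) _ (fun _ _ => rfl)
      exact (h1 a' b' hsep').1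
  -- the two non-negative remainders
  have hW₁ : 0 ≤ (T.schwinger 2 (fun _ => s) (SchwartzMap.tensorFin 2 ![f₁, g]) -
      T.schwinger 1 (fun _ => s) (SchwartzMap.tensorFin 1 ![f₁]) *
        T.schwinger 1 (fun _ => s) (SchwartzMap.tensorFin 1 ![g])).re :=
    hNN f₁ g (fun x => ⟨(hf₁re x).1, (hf₁re x).2, (hre x).2.2.1, (hre x).2.2.2⟩)
      ⟨δ, hδ, fun x hx y hy => hsep x (hf₁_supp hx) y hy⟩
  have hW₂ : 0 ≤ (T.schwinger 2 (fun _ => s) (SchwartzMap.tensorFin 2 ![(c : ℂ) • φa, g₁]) -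
      T.schwinger 1 (fun _ => s) (SchwartzMap.tensorFin 1 ![(c : ℂ) • φa]) *
        T.schwinger 1 (fun _ => s) (SchwartzMap.tensorFin 1 ![g₁])).re :=
    hNN _ g₁ (fun x => ⟨(hcφa x).1, (hcφa x).2.1, (hg₁re x).1, (hg₁re x).2⟩)
      ⟨δ, hδ, fun x hx y hy => hsep x (hφa_supp hx) y (hg₁_supp hy)⟩
  -- bilinear decomposition `W(f,g) = W(f₁,g) + W(cφ_a,g₁) + c² W(φ_a,φ_b)`
  have hfdec : f = f₁ + (c : ℂ) • φa := by rw [hf₁, sub_add_cancel]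
  have hgdec : g = g₁ + (c : ℂ) • φb := by rw [hg₁, sub_add_cancel]
  have h2 : T.schwinger 2 (fun _ => s) (SchwartzMap.tensorFin 2 ![f, g]) =
      T.schwinger 2 (fun _ => s) (SchwartzMap.tensorFin 2 ![f₁, g]) +
        T.schwinger 2 (fun _ => s) (SchwartzMap.tensorFin 2 ![(c : ℂ) • φa, g₁]) +
          (c : ℂ) ^ 2 * T.schwinger 2 (fun _ => s) (SchwartzMap.tensorFin 2 ![φa, φb]) := by
    have hsq : SchwartzMap.tensorFin 2 ![(c : ℂ) • φa, (c : ℂ) • φb] = (c : ℂ) ^ 2 • SchwartzMap.tensorFin 2 ![φa, φb] := by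
      rw [tensorFin_two_smul_left, tensorFin_two_smul_right, smul_smul, sq]
    conv_lhs => rw [hfdec]
    rw [tensorFin_two_add_left, map_add]
    conv_lhs => arg 2; rw [hgdec]
    rw [tensorFin_two_add_right, map_add, hsq, map_smul, smul_eq_mul]
    ring
  have tensorFin_one_add : ∀ u u' : 𝓢(EuclideanSpace ℝ (Fin d), ℂ),
      SchwartzMap.tensorFin 1 ![u + u'] = SchwartzMap.tensorFin 1 ![u] + SchwartzMap.tensorFin 1 ![u'] := fun u u' => by
    ext x
    simp only [tensorFin_one_eval, add_apply]
  have h1f : T.schwinger 1 (fun _ => s) (SchwartzMap.tensorFin 1 ![f]) =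
      T.schwinger 1 (fun _ => s) (SchwartzMap.tensorFin 1 ![f₁]) +
        (c : ℂ) * T.schwinger 1 (fun _ => s) (SchwartzMap.tensorFin 1 ![φa]) := by
    conv_lhs => rw [hfdec]
    rw [tensorFin_one_add, map_add, tensorFin_one_smul, map_smul, smul_eq_mul]
  have h1g : T.schwinger 1 (fun _ => s) (SchwartzMap.tensorFin 1 ![g]) =
      T.schwinger 1 (fun _ => s) (SchwartzMap.tensorFin 1 ![g₁]) +
        (c : ℂ) * T.schwinger 1 (fun _ => s) (SchwartzMap.tensorFin 1 ![φb]) := by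
    conv_lhs => rw [hgdec]
    rw [tensorFin_one_add, map_add, tensorFin_one_smul, map_smul, smul_eq_mul]
  have h1c : T.schwinger 1 (fun _ => s) (SchwartzMap.tensorFin 1 ![(c : ℂ) • φa]) =
      (c : ℂ) * T.schwinger 1 (fun _ => s) (SchwartzMap.tensorFin 1 ![φa]) := by
    rw [tensorFin_one_smul, map_smul, smul_eq_mul]
  have hdec : T.schwinger 2 (fun _ => s) (SchwartzMap.tensorFin 2 ![f, g]) -
      T.schwinger 1 (fun _ => s) (SchwartzMap.tensorFin 1 ![f]) * T.schwinger 1 (fun _ => s) (SchwartzMap.tensorFin 1 ![g]) =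
      (T.schwinger 2 (fun _ => s) (SchwartzMap.tensorFin 2 ![f₁, g]) -
        T.schwinger 1 (fun _ => s) (SchwartzMap.tensorFin 1 ![f₁]) * T.schwinger 1 (fun _ => s) (SchwartzMap.tensorFin 1 ![g])) +
      (T.schwinger 2 (fun _ => s) (SchwartzMap.tensorFin 2 ![(c : ℂ) • φa, g₁]) -
        T.schwinger 1 (fun _ => s) (SchwartzMap.tensorFin 1 ![(c : ℂ) • φa]) *
          T.schwinger 1 (fun _ => s) (SchwartzMap.tensorFin 1 ![g₁])) +
      (c : ℂ) ^ 2 * (T.schwinger 2 (fun _ => s) (SchwartzMap.tensorFin 2 ![φa, φb]) -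
        T.schwinger 1 (fun _ => s) (SchwartzMap.tensorFin 1 ![φa]) * T.schwinger 1 (fun _ => s) (SchwartzMap.tensorFin 1 ![φb])) := by
    rw [h2, h1f, h1g, h1c]
    ring
  rw [hdec, Complex.add_re, Complex.add_re]
  have hc2 : (((c : ℂ) ^ 2 * (T.schwinger 2 (fun _ => s) (SchwartzMap.tensorFin 2 ![φa, φb]) -
        T.schwinger 1 (fun _ => s) (SchwartzMap.tensorFin 1 ![φa]) *
          T.schwinger 1 (fun _ => s) (SchwartzMap.tensorFin 1 ![φb]))).re) =
      c ^ 2 * (T.schwinger 2 (fun _ => s) (SchwartzMap.tensorFin 2 ![φa, φb]) -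
        T.schwinger 1 (fun _ => s) (SchwartzMap.tensorFin 1 ![φa]) *
          T.schwinger 1 (fun _ => s) (SchwartzMap.tensorFin 1 ![φb])).re := by
    rw [← Complex.ofReal_pow, Complex.re_ofReal_mul]
  rw [hc2]
  have hc2pos : 0 < c ^ 2 := by positivity
  nlinarith [hW₁, hW₂, hWpos, hc2pos, mul_pos hc2pos hWpos]

end Summit.QuantumFields.YangMills.Cruxes.ContinuumLegGivenGap.DualitySelectionNloSkewness

end
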